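import Mathlib.Analysis.Asymptotics.SuperpolynomialDecay
import HarnessLib

-- provenance: harness21/H21/H21/Statements/CryptoFoundations/Wave0.lean @ cb1f412 (interim HEAD d8f2665); M5 mechanical rewrite
/-!
# Crypto foundations — Wave 0 statements

Family: `crypto-foundations` (foundations of cryptography: one-way functions,
negligible functions, pseudorandomness).

## Covered statement ids

* **crypto-foundations.S03** — negligible functions (Goldreich, *Foundations of Cryptography*
  vol. 1, 2001, Definition 1.3.5): `μ : ℕ → ℝ` is negligible iff for every positive polynomial
  `p` (equivalently, every `c : ℕ`) there is `N` with `|μ n| < n ^ (-c)` for all `n > N`.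

## Skipped statement ids

* S01, S02, S04–S26: marked `statable_today: false` in the gap inventory; they need the
  probabilistic polynomial-time machine model (`ppt_machine`), OWF/PRG definitions, a universal
  time-bounded Turing machine and Kolmogorov complexity, none of which exist in Mathlib yet.

## Design choices

* Mathlib's anchor for negligible functions is `Asymptotics.SuperpolynomialDecay` with parameter
  map `k := fun n : ℕ => (n : ℝ)` along `Filter.atTop` (its module docstring names negligible
  functions explicitly). We therefore define `Literature.Computability.Cryptography.IsNegligible` as an
  abbreviation of that predicate, so all of Mathlib's API applies, and separately record
  Goldreich's textbook `∀ c ∃ N ∀ n > N` form as the `Prop`-valued definition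
  `IsNegligibleTextbook`, together with the (known, elementary) equivalence
  `isNegligible_iff_textbook` left as `sorry`.
* We take `μ : ℕ → ℝ` (not `ℕ → [0,1]`) and use `|μ n|`, as Mathlib does; for `[0,1]`-valued
  functions this is literally Goldreich's definition.
-/

namespace Literature.Computability.Cryptography

open Filter Asymptotics

/-- A function `μ : ℕ → ℝ` is *negligible* if it decays faster than the inverse of every
polynomial, i.e. `n ^ c * μ n → 0` for every `c : ℕ`. This is Mathlib's
`Asymptotics.SuperpolynomialDecay atTop (fun n : ℕ => (n : ℝ)) μ`.
Goldreich, *Foundations of Cryptography* vol. 1 (2001), Definition 1.3.5. [folklore] -/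
abbrev IsNegligible (μ : ℕ → ℝ) : Prop :=
  SuperpolynomialDecay atTop (fun n : ℕ => (n : ℝ)) μ

/-- **crypto-foundations.S03** (negligible function, textbook form; Goldreich 2001, Def. 1.3.5).
`μ : ℕ → ℝ` is negligible iff for every `c : ℕ` there exists `N` such that for all `n > N`,
`|μ n| < n ^ (-c)`. (Goldreich states it for `μ : ℕ → [0,1]` and every positive polynomial
`p`, `μ(n) < 1/p(n)`; quantifying over monomials `n ^ c` is equivalent.) [cite: Goldreich2001, Def. 1.3.5] -/
def IsNegligibleTextbook (μ : ℕ → ℝ) : Prop :=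
  ∀ c : ℕ, ∃ N : ℕ, ∀ n : ℕ, N < n → |μ n| < (n : ℝ) ^ (-(c : ℤ))

/-- **crypto-foundations.S03** (equivalence of the two forms; Goldreich 2001, Def. 1.3.5 and the
discussion following it; cf. Mathlib's `Asymptotics.superpolynomialDecay_iff_isLittleO`).
Mathlib's superpolynomial-decay predicate at parameter `n ↦ (n : ℝ)` coincides with the
textbook `∀ c ∃ N ∀ n > N, |μ n| < n^{-c}` definition of a negligible function. [cite: Goldreich2001, Def. 1.3.5 and the discussion following] -/
def isNegligible_iff_textbook : Prop :=
  ∀ (μ : ℕ → ℝ),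
    IsNegligible μ ↔ IsNegligibleTextbook μ

/-- The zero function is negligible (sanity check that the Mathlib API applies to
`IsNegligible`; Goldreich 2001, §1.3.3). [cite: Goldreich2001, §1.3.3] -/
theorem isNegligible_zero : IsNegligible (0 : ℕ → ℝ) :=
  superpolynomialDecay_zero _ _

/-- The sum of two negligible functions is negligible (Goldreich 2001, §1.3.3, remark after
Def. 1.3.5). [cite: Goldreich2001, §1.3.3  remark after Def. 1.3.5] -/
theorem IsNegligible.add {μ ν : ℕ → ℝ} (hμ : IsNegligible μ) (hν : IsNegligible ν) :
    IsNegligible (μ + ν) :=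
  SuperpolynomialDecay.add hμ hν

/-- A negligible function times a polynomial is negligible (Goldreich 2001, §1.3.3: "for every
positive polynomial `p`, `p(n) · μ(n)` is negligible"). [cite: Goldreich2001, §1.3.3: "for every positive polynomial] -/
theorem IsNegligible.polynomial_mul {μ : ℕ → ℝ} (hμ : IsNegligible μ) (p : Polynomial ℝ) :
    IsNegligible (fun n => p.eval (n : ℝ) * μ n) :=
  SuperpolynomialDecay.polynomial_mul hμ p

end Literature.Computability.Cryptography
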